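import Summits.CriticalPhenomena.PercolationContinuityZ3.Theorems.Transplant.FKConnectivityAllQPat3SPSteps
import Summits.CriticalPhenomena.PercolationContinuityZ3.Theorems.Transplant.FKConnectivityAllQSPReroot
import HarnessLib

/-!
# Connectivity correlation inequalities for `φ_{w,q}`, every `q > 0` — THEOREM SP: the structural recursion (type I, re-rooting)

Proof file (`--supports stmt-CriticalPhenomena-4575`), census lineage (gen 37) of LANE 2's FK sub-programme; builds on p205010
(kernel theorem, internal audit signed; external expert review pending).  No definitions, no named facts, no sorries.

THE TYPE-I RECURSION (census g37; replaces census g34's Lemma Θ₃ and its decomposition-tree / LCA / Duffin apparatus).  Let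
`E₁ ∥ E₂` be a parallel composition of two-terminal series–parallel `(x, y)`-networks with `x, y` UNMARKED, two marks `s, t` inner in
`E₁` and one mark `b` inner in `E₂` (a "type-I" 2-cut of census g32 §1.3 — the one configuration that is not a product-cone step).
Invert the last constructor of `IsTTSP E₁ x y`:
* `E₁ = Q₁ ∥ Q₂`: if `s, t` lie on different parts the union is a THETA graph `E₂ ∥ Q₁ ∥ Q₂` (`FK.spGood_theta`); otherwise
  re-associate `E = Q₁ ∥ (Q₂ ∥ E₂)` and recurse on the smaller two-mark side `Q₁`;
* `E₁ = F₁ ·ₘ F₂`: if `s ∈ F₁°`, `t ∈ F₂°` the union is the RING `E₂ᵀ(y,x) · F₁(x,m) · F₂(m,y)` (`FK.spGood_ring`); if the junction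
  `m` is one of the two marks, RE-ROOT at `(m, x)` or `(m, y)`: `E = F₁ ∥ (F₂ · E₂ᵀ)` resp. `F₂ ∥ (F₁ᵀ · E₂)` is a CORNER
  (`FK.spGood_corner`, the marked corner being `m`); if both marks lie in `F₁°` (resp. `F₂°`) the same re-rooting is again type I with
  the smaller two-mark side `F₁` (resp. `F₂`) — recurse.
Termination: the cardinality of the two-mark side.  Every leaf is one of census g36's kernel-checked certificates; no minors, no
3C reductions and no decomposition trees are needed.  Re-rooting lemmas: `FK.reroot_serA/serB/par`.
[cite: AyyerLinussonRavichandran2025, §7 (p. 22)] [cite: Grimmett2006, §3.8 (pp. 61–62)]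
-/

namespace Summit.CriticalPhenomena.PercolationContinuityZ3.Theorems

namespace FK

open SimpleGraph Literature.Probability.LatticeModels Literature.Probability.Percolation
open scoped Classical

variable {V : Type*}

/-! ### Re-rooting a parallel composition whose first part is a series composition -/

section Reroot

variable {F₁ F₂ E₂ : Finset (Sym2 V)} {x m y : V}

/-- A two-terminal series–parallel network has an edge. [folklore] -/
theorem IsTTSP.card_pos {E : Finset (Sym2 V)} {s t : V} (h : IsTTSP E s t) : 0 < E.card := by
  obtain ⟨e, he, -⟩ := h.left_mem
  exact Finset.card_pos.2 ⟨e, he⟩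

/-- In a parallel composition the first part is smaller than the whole. [folklore] -/
theorem card_left_lt_of_parallel {Q₁ Q₂ : Finset (Sym2 V)} {s t : V} (h₂ : IsTTSP Q₂ s t) (hd : Disjoint Q₁ Q₂) :
    Q₁.card < (Q₁ ∪ Q₂).card := by
  rw [Finset.card_union_of_disjoint hd]
  have := h₂.card_pos
  omega

/-- In a parallel composition the second part is smaller than the whole. [folklore] -/
theorem card_right_lt_of_parallel {Q₁ Q₂ : Finset (Sym2 V)} {s t : V} (h₁ : IsTTSP Q₁ s t) (hd : Disjoint Q₁ Q₂) :
    Q₂.card < (Q₁ ∪ Q₂).card := by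
  rw [Finset.card_union_of_disjoint hd]
  have := h₁.card_pos
  omega

/-- The junction of a series composition inside a parallel composition is off the other parallel part. [folklore] -/
theorem junction_not_mem (hV : ∀ z : V, (∃ e ∈ F₁ ∪ F₂, z ∈ e) → (∃ e ∈ E₂, z ∈ e) → z = x ∨ z = y)
    (hF₁ : IsTTSP F₁ x m) (hF₂ : IsTTSP F₂ m y) : ∀ e ∈ E₂, m ∉ e := by
  intro e he hme
  obtain ⟨f, hf, hmf⟩ := hF₁.right_mem
  rcases hV m ⟨f, Finset.mem_union_left _ hf, hmf⟩ ⟨e, he, hme⟩ with h | h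
  · exact hF₁.ne h.symm
  · exact hF₂.ne h

/-- **Re-rooting A:** `E = (F₁ ·ₘ F₂) ∥ E₂` between `x, y` is also `F₁ ∥ (F₂ · E₂ᵀ)` between `m` and `x`: the series composition
`F₂(m,y) · E₂(y,x)` is a two-terminal series–parallel `(m, x)`-network, edge-disjoint from `F₁` and meeting it inside `{m, x}`. [folklore] -/
theorem reroot_serA (h₂ : IsTTSP E₂ x y) (hd : Disjoint (F₁ ∪ F₂) E₂)
    (hV : ∀ z : V, (∃ e ∈ F₁ ∪ F₂, z ∈ e) → (∃ e ∈ E₂, z ∈ e) → z = x ∨ z = y)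
    (hF₁ : IsTTSP F₁ x m) (hF₂ : IsTTSP F₂ m y) (hdF : Disjoint F₁ F₂)
    (hVF : ∀ z : V, (∃ e ∈ F₁, z ∈ e) → (∃ e ∈ F₂, z ∈ e) → z = m) (hxF₂ : ∀ e ∈ F₂, x ∉ e) (hyF₁ : ∀ e ∈ F₁, y ∉ e) :
    IsTTSP (F₂ ∪ E₂) m x ∧ Disjoint F₁ (F₂ ∪ E₂) ∧
      (∀ z : V, (∃ e ∈ F₁, z ∈ e) → (∃ e ∈ F₂ ∪ E₂, z ∈ e) → z = m ∨ z = x) := by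
  have hd1 : Disjoint F₁ E₂ := (Finset.disjoint_union_left.1 hd).1
  have hd2 : Disjoint F₂ E₂ := (Finset.disjoint_union_left.1 hd).2
  refine ⟨IsTTSP.series hF₂ h₂.symm hd2 (fun z hz2 hzE => ?_) (junction_not_mem hV hF₁ hF₂) hxF₂,
    Finset.disjoint_union_right.2 ⟨hdF, hd1⟩, fun z hz1 hz => ?_⟩
  · obtain ⟨e, he, hze⟩ := hz2
    rcases hV z ⟨e, Finset.mem_union_right _ he, hze⟩ hzE with h | h
    · exact absurd hze (h ▸ hxF₂ e he)
    · exact h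
  · obtain ⟨e, he, hze⟩ := hz
    rcases Finset.mem_union.1 he with he | he
    · exact Or.inl (hVF z hz1 ⟨e, he, hze⟩)
    · obtain ⟨f, hf, hzf⟩ := hz1
      rcases hV z ⟨f, Finset.mem_union_left _ hf, hzf⟩ ⟨e, he, hze⟩ with h | h
      · exact Or.inr h
      · exact absurd hzf (h ▸ hyF₁ f hf)

/-- **Re-rooting B:** `E = (F₁ ·ₘ F₂) ∥ E₂` between `x, y` is also `F₂ ∥ (F₁ᵀ · E₂)` between `m` and `y`. [folklore] -/
theorem reroot_serB (h₂ : IsTTSP E₂ x y) (hd : Disjoint (F₁ ∪ F₂) E₂)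
    (hV : ∀ z : V, (∃ e ∈ F₁ ∪ F₂, z ∈ e) → (∃ e ∈ E₂, z ∈ e) → z = x ∨ z = y)
    (hF₁ : IsTTSP F₁ x m) (hF₂ : IsTTSP F₂ m y) (hdF : Disjoint F₁ F₂)
    (hVF : ∀ z : V, (∃ e ∈ F₁, z ∈ e) → (∃ e ∈ F₂, z ∈ e) → z = m) (hxF₂ : ∀ e ∈ F₂, x ∉ e) (hyF₁ : ∀ e ∈ F₁, y ∉ e) :
    IsTTSP (F₁ ∪ E₂) m y ∧ Disjoint F₂ (F₁ ∪ E₂) ∧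
      (∀ z : V, (∃ e ∈ F₂, z ∈ e) → (∃ e ∈ F₁ ∪ E₂, z ∈ e) → z = m ∨ z = y) := by
  have hd1 : Disjoint F₁ E₂ := (Finset.disjoint_union_left.1 hd).1
  have hd2 : Disjoint F₂ E₂ := (Finset.disjoint_union_left.1 hd).2
  refine ⟨IsTTSP.series hF₁.symm h₂ hd1 (fun z hz1 hzE => ?_) (junction_not_mem hV hF₁ hF₂) hyF₁,
    Finset.disjoint_union_right.2 ⟨hdF.symm, hd2⟩, fun z hz2 hz => ?_⟩
  · obtain ⟨e, he, hze⟩ := hz1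
    rcases hV z ⟨e, Finset.mem_union_left _ he, hze⟩ hzE with h | h
    · exact h
    · exact absurd hze (h ▸ hyF₁ e he)
  · obtain ⟨e, he, hze⟩ := hz
    rcases Finset.mem_union.1 he with he | he
    · exact Or.inl (hVF z ⟨e, he, hze⟩ hz2).symm.symm
    · obtain ⟨f, hf, hzf⟩ := hz2
      rcases hV z ⟨f, Finset.mem_union_right _ hf, hzf⟩ ⟨e, he, hze⟩ with h | h
      · exact absurd hzf (h ▸ hxF₂ f hf)
      · exact Or.inr h

/-- **Re-associating a parallel composition:** `E = (Q₁ ∥ Q₂) ∥ E₂` is `Q₁ ∥ (Q₂ ∥ E₂)`. [folklore] -/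
theorem reroot_par {Q₁ Q₂ E₂ : Finset (Sym2 V)} {x y : V} (h₂ : IsTTSP E₂ x y) (hd : Disjoint (Q₁ ∪ Q₂) E₂)
    (hV : ∀ z : V, (∃ e ∈ Q₁ ∪ Q₂, z ∈ e) → (∃ e ∈ E₂, z ∈ e) → z = x ∨ z = y)
    (hQ₂ : IsTTSP Q₂ x y) (hdQ : Disjoint Q₁ Q₂)
    (hVQ : ∀ z : V, (∃ e ∈ Q₁, z ∈ e) → (∃ e ∈ Q₂, z ∈ e) → z = x ∨ z = y) :
    IsTTSP (Q₂ ∪ E₂) x y ∧ Disjoint Q₁ (Q₂ ∪ E₂) ∧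
      (∀ z : V, (∃ e ∈ Q₁, z ∈ e) → (∃ e ∈ Q₂ ∪ E₂, z ∈ e) → z = x ∨ z = y) := by
  have hd1 : Disjoint Q₁ E₂ := (Finset.disjoint_union_left.1 hd).1
  have hd2 : Disjoint Q₂ E₂ := (Finset.disjoint_union_left.1 hd).2
  refine ⟨IsTTSP.parallel hQ₂ h₂ hd2 fun z hz2 hzE => ?_, Finset.disjoint_union_right.2 ⟨hdQ, hd1⟩, fun z hz1 hz => ?_⟩
  · obtain ⟨e, he, hze⟩ := hz2
    exact hV z ⟨e, Finset.mem_union_right _ he, hze⟩ hzE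
  · obtain ⟨e, he, hze⟩ := hz
    rcases Finset.mem_union.1 he with he | he
    · exact hVQ z hz1 ⟨e, he, hze⟩
    · obtain ⟨f, hf, hzf⟩ := hz1
      exact hV z ⟨f, Finset.mem_union_left _ hf, hzf⟩ ⟨e, he, hze⟩

/-- The same re-association with the roles of `Q₁`, `Q₂` exchanged: `E = Q₂ ∥ (Q₁ ∥ E₂)`. [folklore] -/
theorem reroot_par' {Q₁ Q₂ E₂ : Finset (Sym2 V)} {x y : V} (h₂ : IsTTSP E₂ x y) (hd : Disjoint (Q₁ ∪ Q₂) E₂)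
    (hV : ∀ z : V, (∃ e ∈ Q₁ ∪ Q₂, z ∈ e) → (∃ e ∈ E₂, z ∈ e) → z = x ∨ z = y)
    (hQ₁ : IsTTSP Q₁ x y) (hdQ : Disjoint Q₁ Q₂)
    (hVQ : ∀ z : V, (∃ e ∈ Q₁, z ∈ e) → (∃ e ∈ Q₂, z ∈ e) → z = x ∨ z = y) :
    IsTTSP (Q₁ ∪ E₂) x y ∧ Disjoint Q₂ (Q₁ ∪ E₂) ∧
      (∀ z : V, (∃ e ∈ Q₂, z ∈ e) → (∃ e ∈ Q₁ ∪ E₂, z ∈ e) → z = x ∨ z = y) := by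
  rw [Finset.union_comm] at hd hV
  exact reroot_par h₂ hd hV hQ₁ hdQ.symm fun z hz2 hz1 => hVQ z hz1 hz2

end Reroot

/-! ### The type-I recursion -/

section TypeI

variable [Fintype V] {F₁ F₂ E₂ : Finset (Sym2 V)} {x m y : V}

/-- Type I, series case with a mark at the junction `m`: after re-rooting at `(m, x)` or `(m, y)` the union is a CORNER with the
marked corner `m`. [cite: AyyerLinussonRavichandran2025, §7 (p. 22)] -/
theorem typeI_junction {b t : V} (h₂ : IsTTSP E₂ x y) (hd : Disjoint (F₁ ∪ F₂) E₂)
    (hV : ∀ z : V, (∃ e ∈ F₁ ∪ F₂, z ∈ e) → (∃ e ∈ E₂, z ∈ e) → z = x ∨ z = y)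
    (hF₁ : IsTTSP F₁ x m) (hF₂ : IsTTSP F₂ m y) (hdF : Disjoint F₁ F₂)
    (hVF : ∀ z : V, (∃ e ∈ F₁, z ∈ e) → (∃ e ∈ F₂, z ∈ e) → z = m) (hxF₂ : ∀ e ∈ F₂, x ∉ e) (hyF₁ : ∀ e ∈ F₁, y ∉ e)
    (ht : ∃ e ∈ F₁ ∪ F₂, t ∈ e) (htm : t ≠ m) (htx : t ≠ x) (hty : t ≠ y)
    (hb : ∃ e ∈ E₂, b ∈ e) (hbx : b ≠ x) (hby : b ≠ y) : SPGood (F₁ ∪ F₂ ∪ E₂) b m t := by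
  obtain ⟨eb, heb, hbeb⟩ := hb
  have hbm : b ≠ m := fun h => junction_not_mem hV hF₁ hF₂ eb heb (h ▸ hbeb)
  rcases span_union ht with ht1 | ht2
  · obtain ⟨hA, hdA, hVA⟩ := reroot_serA h₂ hd hV hF₁ hF₂ hdF hVF hxF₂ hyF₁
    have hc := spGood_corner hdA hVA hF₁.symm hA ht1 ⟨eb, Finset.mem_union_right _ heb, hbeb⟩ htm htx hbm hbx
    exact hc.rotate'.congr_edges (Finset.union_assoc _ _ _).symm
  · obtain ⟨hB, hdB, hVB⟩ := reroot_serB h₂ hd hV hF₁ hF₂ hdF hVF hxF₂ hyF₁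
    have hc := spGood_corner hdB hVB hF₂ hB ht2 ⟨eb, Finset.mem_union_right _ heb, hbeb⟩ htm hty hbm hby
    exact hc.rotate'.congr_edges (by rw [← Finset.union_assoc, Finset.union_comm F₂ F₁])

/-- Type I, series case with the two marks on different blocks: the union is a RING. [cite: AyyerLinussonRavichandran2025, §7 (p. 22)] -/
theorem typeI_ring {b s t : V} (h₂ : IsTTSP E₂ x y) (hd : Disjoint (F₁ ∪ F₂) E₂)
    (hV : ∀ z : V, (∃ e ∈ F₁ ∪ F₂, z ∈ e) → (∃ e ∈ E₂, z ∈ e) → z = x ∨ z = y)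
    (hF₁ : IsTTSP F₁ x m) (hF₂ : IsTTSP F₂ m y) (hdF : Disjoint F₁ F₂)
    (hVF : ∀ z : V, (∃ e ∈ F₁, z ∈ e) → (∃ e ∈ F₂, z ∈ e) → z = m) (hxF₂ : ∀ e ∈ F₂, x ∉ e) (hyF₁ : ∀ e ∈ F₁, y ∉ e)
    (hs : ∃ e ∈ F₁, s ∈ e) (hsm : s ≠ m) (hsx : s ≠ x) (ht : ∃ e ∈ F₂, t ∈ e) (htm : t ≠ m) (hty : t ≠ y)
    (hb : ∃ e ∈ E₂, b ∈ e) (hbx : b ≠ x) (hby : b ≠ y) : SPGood (F₁ ∪ F₂ ∪ E₂) b s t := by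
  have hd1 : Disjoint F₁ E₂ := (Finset.disjoint_union_left.1 hd).1
  have hd2 : Disjoint F₂ E₂ := (Finset.disjoint_union_left.1 hd).2
  have hVK1 : ∀ z : V, (∃ e ∈ E₂, z ∈ e) → (∃ e ∈ F₁, z ∈ e) → z = x := fun z hzE hz1 => by
    obtain ⟨f, hf, hzf⟩ := hz1
    rcases hV z ⟨f, Finset.mem_union_left _ hf, hzf⟩ hzE with h | h
    · exact h
    · exact absurd hzf (h ▸ hyF₁ f hf)
  have hVK2 : ∀ z : V, (∃ e ∈ E₂, z ∈ e) → (∃ e ∈ F₂, z ∈ e) → z = y := fun z hzE hz2 => by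
    obtain ⟨f, hf, hzf⟩ := hz2
    rcases hV z ⟨f, Finset.mem_union_right _ hf, hzf⟩ hzE with h | h
    · exact absurd hzf (h ▸ hxF₂ f hf)
    · exact h
  have hu2 : ¬ ∃ e ∈ F₂, x ∈ e := fun ⟨e, he, hxe⟩ => hxF₂ e he hxe
  have hv1 : ¬ ∃ e ∈ F₁, y ∈ e := fun ⟨e, he, hye⟩ => hyF₁ e he hye
  have hr := spGood_ring hd1.symm hd2.symm hdF hVK1 hVF hVK2 hu2 hv1 hF₁.ne hF₂.ne.symm h₂.symm hF₁ hF₂ hb hs ht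
    hbx hby hsx hsm hty htm
  exact hr.congr_edges (by rw [Finset.union_assoc, Finset.union_comm])

/-- **THE TYPE-I RECURSION (census g37):** a parallel composition `E₁ ∥ E₂` of two-terminal series–parallel `(x, y)`-networks with
unmarked terminals, two marks `s, t` inner in `E₁` and one mark `b` inner in `E₂`: `T_sym` and the three `STAR`s are levelwise
nonnegative on `E₁ ∪ E₂`.  By recursion on `|E₁|` through THETA / RING / CORNER leaves (see the file header).
[cite: AyyerLinussonRavichandran2025, §7 (p. 22)] -/
theorem typeI_good : ∀ (n : ℕ) {E₁ E₂ : Finset (Sym2 V)} {x y b s t : V}, E₁.card ≤ n →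
    IsTTSP E₁ x y → IsTTSP E₂ x y → Disjoint E₁ E₂ →
    (∀ z : V, (∃ e ∈ E₁, z ∈ e) → (∃ e ∈ E₂, z ∈ e) → z = x ∨ z = y) →
    (∃ e ∈ E₁, s ∈ e) → (∃ e ∈ E₁, t ∈ e) → (∃ e ∈ E₂, b ∈ e) →
    s ≠ x → s ≠ y → t ≠ x → t ≠ y → b ≠ x → b ≠ y → s ≠ t → SPGood (E₁ ∪ E₂) b s t := by
  intro n
  induction n with
  | zero =>
    intro E₁ E₂ x y b s t hcard h₁ _ _ _ _ _ _ _ _ _ _ _ _ _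
    have := h₁.card_pos
    omega
  | succ n ih =>
    intro E₁ E₂ x y b s t hcard h₁ h₂ hd hV hs ht hb hsx hsy htx hty hbx hby hst
    cases h₁ with
    | edge hxy =>
      obtain ⟨e, he, hse⟩ := hs
      rw [Finset.mem_singleton] at he
      subst he
      rcases Sym2.mem_iff.1 hse with h | h
      · exact absurd h hsx
      · exact absurd h hsy
    | @parallel Q₁ Q₂ _ _ hQ₁ hQ₂ hdQ hVQ =>
      have hlt1 := card_left_lt_of_parallel hQ₂ hdQ
      have hlt2 := card_right_lt_of_parallel hQ₁ hdQ
      have hd1 : Disjoint Q₁ E₂ := (Finset.disjoint_union_left.1 hd).1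
      have hd2 : Disjoint Q₂ E₂ := (Finset.disjoint_union_left.1 hd).2
      have hVK1 : ∀ z : V, (∃ e ∈ E₂, z ∈ e) → (∃ e ∈ Q₁, z ∈ e) → z = x ∨ z = y := fun z hzE hz1 => by
        obtain ⟨f, hf, hzf⟩ := hz1
        exact hV z ⟨f, Finset.mem_union_left _ hf, hzf⟩ hzE
      have hVK2 : ∀ z : V, (∃ e ∈ E₂, z ∈ e) → (∃ e ∈ Q₂, z ∈ e) → z = x ∨ z = y := fun z hzE hz2 => by
        obtain ⟨f, hf, hzf⟩ := hz2
        exact hV z ⟨f, Finset.mem_union_right _ hf, hzf⟩ hzE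
      obtain ⟨eb, heb, hbeb⟩ := hb
      rcases span_union hs with hs1 | hs2 <;> rcases span_union ht with ht1 | ht2
      · obtain ⟨hP, hdP, hVP⟩ := reroot_par h₂ hd hV hQ₂ hdQ hVQ
        have hr := ih (by omega) hQ₁ hP hdP hVP hs1 ht1 ⟨eb, Finset.mem_union_right _ heb, hbeb⟩ hsx hsy htx hty hbx hby hst
        exact hr.congr_edges (Finset.union_assoc _ _ _).symm
      · have hr := spGood_theta hd1.symm hd2.symm hdQ hVK1 hVK2 hVQ h₂ hQ₁ hQ₂ ⟨eb, heb, hbeb⟩ hs1 ht2 hbx hby hsx hsy htx hty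
        exact hr.congr_edges (by rw [Finset.union_assoc, Finset.union_comm])
      · have hr := spGood_theta hd2.symm hd1.symm hdQ.symm hVK2 hVK1 (fun z hz2 hz1 => hVQ z hz1 hz2) h₂ hQ₂ hQ₁ ⟨eb, heb, hbeb⟩
          hs2 ht1 hbx hby hsx hsy htx hty
        exact hr.congr_edges (by rw [Finset.union_assoc, Finset.union_comm, Finset.union_comm Q₂ Q₁])
      · obtain ⟨hP, hdP, hVP⟩ := reroot_par' h₂ hd hV hQ₁ hdQ hVQ
        have hr := ih (by omega) hQ₂ hP hdP hVP hs2 ht2 ⟨eb, Finset.mem_union_right _ heb, hbeb⟩ hsx hsy htx hty hbx hby hst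
        exact hr.congr_edges (by rw [← Finset.union_assoc, Finset.union_comm Q₂ Q₁])
    | @series F₁ F₂ _ m _ hF₁ hF₂ hdF hVF hxF₂ hyF₁ =>
      have hlt1 := card_left_lt_of_parallel hF₂ hdF
      have hlt2 := card_right_lt_of_parallel hF₁ hdF
      by_cases hsm : s = m
      · subst hsm
        exact typeI_junction h₂ hd hV hF₁ hF₂ hdF hVF hxF₂ hyF₁ ht (Ne.symm hst) htx hty hb hbx hby
      by_cases htm : t = m
      · subst htm
        exact (typeI_junction h₂ hd hV hF₁ hF₂ hdF hVF hxF₂ hyF₁ hs hsm hsx hsy hb hbx hby).swap23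
      obtain ⟨eb, heb, hbeb⟩ := hb
      have hbm : b ≠ m := fun h => junction_not_mem hV hF₁ hF₂ eb heb (h ▸ hbeb)
      rcases span_union hs with hs1 | hs2 <;> rcases span_union ht with ht1 | ht2
      · obtain ⟨hA, hdA, hVA⟩ := reroot_serA h₂ hd hV hF₁ hF₂ hdF hVF hxF₂ hyF₁
        have hr := ih (by omega) hF₁.symm hA hdA hVA hs1 ht1 ⟨eb, Finset.mem_union_right _ heb, hbeb⟩ hsm hsx htm htx hbm
          hbx hst
        exact hr.congr_edges (Finset.union_assoc _ _ _).symm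
      · exact typeI_ring h₂ hd hV hF₁ hF₂ hdF hVF hxF₂ hyF₁ hs1 hsm hsx ht2 htm hty ⟨eb, heb, hbeb⟩ hbx hby
      · exact (typeI_ring h₂ hd hV hF₁ hF₂ hdF hVF hxF₂ hyF₁ ht1 htm htx hs2 hsm hsy ⟨eb, heb, hbeb⟩ hbx hby).swap23
      · obtain ⟨hB, hdB, hVB⟩ := reroot_serB h₂ hd hV hF₁ hF₂ hdF hVF hxF₂ hyF₁
        have hr := ih (by omega) hF₂ hB hdB hVB hs2 ht2 ⟨eb, Finset.mem_union_right _ heb, hbeb⟩ hsm hsy htm hty hbm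
          hby hst
        exact hr.congr_edges (by rw [← Finset.union_assoc, Finset.union_comm F₂ F₁])

end TypeI

/-! ### One marked terminal: the recursion `pb` -/

section OneTerminal

variable [Fintype V] {F₁ F₂ E₂ : Finset (Sym2 V)} {x m y : V}

/-- One marked terminal `x`, series case with the junction `m` marked: re-rooted at `(x, m)` the cut `{x, m}` consists of two marks
(`FK.spGood_parTwo`). [cite: AyyerLinussonRavichandran2025, §7 (p. 22)] -/
theorem pb_junction {t : V} (h₂ : IsTTSP E₂ x y) (hd : Disjoint (F₁ ∪ F₂) E₂)
    (hV : ∀ z : V, (∃ e ∈ F₁ ∪ F₂, z ∈ e) → (∃ e ∈ E₂, z ∈ e) → z = x ∨ z = y)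
    (hF₁ : IsTTSP F₁ x m) (hF₂ : IsTTSP F₂ m y) (hdF : Disjoint F₁ F₂)
    (hVF : ∀ z : V, (∃ e ∈ F₁, z ∈ e) → (∃ e ∈ F₂, z ∈ e) → z = m) (hxF₂ : ∀ e ∈ F₂, x ∉ e) (hyF₁ : ∀ e ∈ F₁, y ∉ e)
    (ht : ∃ e ∈ F₁ ∪ F₂, t ∈ e) (htm : t ≠ m) (htx : t ≠ x) : SPGood (F₁ ∪ F₂ ∪ E₂) x m t := by
  obtain ⟨hA, hdA, hVA⟩ := reroot_serA h₂ hd hV hF₁ hF₂ hdF hVF hxF₂ hyF₁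
  have hVA' : ∀ z : V, (∃ e ∈ F₁, z ∈ e) → (∃ e ∈ F₂ ∪ E₂, z ∈ e) → z = x ∨ z = m := fun z h1 h => (hVA z h1 h).symm
  rcases span_union ht with ht1 | ht2
  · have hr := spGood_parTwo hdA.symm (fun z h h1 => hVA' z h1 h) hF₁.ne hF₁ ht1 htx htm
    exact hr.congr_edges (by rw [Finset.union_comm, Finset.union_assoc])
  · have hr := spGood_parTwo hdA hVA' hF₁.ne hA.symm ⟨ht2.choose, Finset.mem_union_left _ ht2.choose_spec.1,
      ht2.choose_spec.2⟩ htx htm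
    exact hr.congr_edges (Finset.union_assoc _ _ _).symm

/-- **ONE MARKED TERMINAL (census g37):** a parallel composition `E₁ ∥ E₂` of two-terminal series–parallel `(x, y)`-networks with `x`
marked, `y` unmarked, and the other two marks `s, t` inner in `E₁`: `T_sym` and the three `STAR`s are levelwise nonnegative on
`E₁ ∪ E₂`.  By recursion on `|E₁|` through CORNER / two-marked-cut / type-I leaves.
[cite: AyyerLinussonRavichandran2025, §7 (p. 22)] -/
theorem pb_good : ∀ (n : ℕ) {E₁ E₂ : Finset (Sym2 V)} {x y s t : V}, E₁.card ≤ n →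
    IsTTSP E₁ x y → IsTTSP E₂ x y → Disjoint E₁ E₂ →
    (∀ z : V, (∃ e ∈ E₁, z ∈ e) → (∃ e ∈ E₂, z ∈ e) → z = x ∨ z = y) →
    (∃ e ∈ E₁, s ∈ e) → (∃ e ∈ E₁, t ∈ e) →
    s ≠ x → s ≠ y → t ≠ x → t ≠ y → s ≠ t → SPGood (E₁ ∪ E₂) x s t := by
  intro n
  induction n with
  | zero =>
    intro E₁ E₂ x y s t hcard h₁ _ _ _ _ _ _ _ _ _ _
    have := h₁.card_pos
    omega
  | succ n ih =>
    intro E₁ E₂ x y s t hcard h₁ h₂ hd hV hs ht hsx hsy htx hty hst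
    cases h₁ with
    | edge hxy =>
      obtain ⟨e, he, hse⟩ := hs
      rw [Finset.mem_singleton] at he
      subst he
      rcases Sym2.mem_iff.1 hse with h | h
      · exact absurd h hsx
      · exact absurd h hsy
    | @parallel Q₁ Q₂ _ _ hQ₁ hQ₂ hdQ hVQ =>
      have hlt1 := card_left_lt_of_parallel hQ₂ hdQ
      have hlt2 := card_right_lt_of_parallel hQ₁ hdQ
      obtain ⟨hP, hdP, hVP⟩ := reroot_par h₂ hd hV hQ₂ hdQ hVQ
      obtain ⟨hP', hdP', hVP'⟩ := reroot_par' h₂ hd hV hQ₁ hdQ hVQ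
      rcases span_union hs with hs1 | hs2 <;> rcases span_union ht with ht1 | ht2
      · exact (ih (by omega) hQ₁ hP hdP hVP hs1 ht1 hsx hsy htx hty hst).congr_edges (Finset.union_assoc _ _ _).symm
      · have hr := spGood_corner hdP hVP hQ₁ hP hs1 ⟨ht2.choose, Finset.mem_union_left _ ht2.choose_spec.1,
          ht2.choose_spec.2⟩ hsx hsy htx hty
        exact hr.congr_edges (Finset.union_assoc _ _ _).symm
      · have hr := spGood_corner hdP' hVP' hQ₂ hP' hs2 ⟨ht1.choose, Finset.mem_union_left _ ht1.choose_spec.1,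
          ht1.choose_spec.2⟩ hsx hsy htx hty
        exact hr.congr_edges (by rw [← Finset.union_assoc, Finset.union_comm Q₂ Q₁])
      · exact (ih (by omega) hQ₂ hP' hdP' hVP' hs2 ht2 hsx hsy htx hty hst).congr_edges
          (by rw [← Finset.union_assoc, Finset.union_comm Q₂ Q₁])
    | @series F₁ F₂ _ m _ hF₁ hF₂ hdF hVF hxF₂ hyF₁ =>
      have hlt1 := card_left_lt_of_parallel hF₂ hdF
      have hlt2 := card_right_lt_of_parallel hF₁ hdF
      by_cases hsm : s = m
      · subst hsm
        exact pb_junction h₂ hd hV hF₁ hF₂ hdF hVF hxF₂ hyF₁ ht (Ne.symm hst) htx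
      by_cases htm : t = m
      · subst htm
        exact (pb_junction h₂ hd hV hF₁ hF₂ hdF hVF hxF₂ hyF₁ hs hsm hsx).swap23
      obtain ⟨hA, hdA, hVA⟩ := reroot_serA h₂ hd hV hF₁ hF₂ hdF hVF hxF₂ hyF₁
      have hVA' : ∀ z : V, (∃ e ∈ F₁, z ∈ e) → (∃ e ∈ F₂ ∪ E₂, z ∈ e) → z = x ∨ z = m :=
        fun z h1 h => (hVA z h1 h).symm
      obtain ⟨hB, hdB, hVB⟩ := reroot_serB h₂ hd hV hF₁ hF₂ hdF hVF hxF₂ hyF₁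
      have nx2 : ∀ {p : V}, (∃ e ∈ F₂, p ∈ e) → p ≠ x := fun ⟨e, he, hpe⟩ h => hxF₂ e he (h ▸ hpe)
      have ny1 : ∀ {p : V}, (∃ e ∈ F₁, p ∈ e) → p ≠ y := fun ⟨e, he, hpe⟩ h => hyF₁ e he (h ▸ hpe)
      rcases span_union hs with hs1 | hs2 <;> rcases span_union ht with ht1 | ht2
      · exact (ih (by omega) hF₁ hA.symm hdA hVA' hs1 ht1 hsx hsm htx htm hst).congr_edges
          (Finset.union_assoc _ _ _).symm
      · have hr := spGood_corner hdA hVA' hF₁ hA.symm hs1 ⟨ht2.choose, Finset.mem_union_left _ ht2.choose_spec.1,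
          ht2.choose_spec.2⟩ hsx hsm htx htm
        exact hr.congr_edges (Finset.union_assoc _ _ _).symm
      · have hr := spGood_corner hdA hVA' hF₁ hA.symm ht1 ⟨hs2.choose, Finset.mem_union_left _ hs2.choose_spec.1,
          hs2.choose_spec.2⟩ htx htm hsx hsm
        exact hr.swap23.congr_edges (Finset.union_assoc _ _ _).symm
      · obtain ⟨ex, hex, hxex⟩ := hF₁.left_mem
        have hr := typeI_good F₂.card le_rfl hF₂ hB hdB hVB hs2 ht2 ⟨ex, Finset.mem_union_left _ hex, hxex⟩ hsm hsy htm hty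
          hF₁.ne h₂.ne hst
        exact hr.congr_edges (by rw [← Finset.union_assoc, Finset.union_comm F₂ F₁])

end OneTerminal




end FK

end Summit.CriticalPhenomena.PercolationContinuityZ3.Theorems
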